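import Summits.AtomisticToContinuum.FouriersLaw.Theorems.ContactStieltjesMeasureStieltjesRepresentationCayleyPencilHerglotzSums

/-!
# Herglotz's theorem for positive-definite real sequences, via Fejér means — the limit measure

Support for `stub_stieltjesOfPencil` (line `cayley-pencil`, crux `StieltjesRepresentation` of route
`ContactStieltjesMeasure`), part 3/5.

For `c : ℕ → ℝ` with nonnegative Toeplitz forms there is a finite positive measure `ρ` on `ℝ` (carried by
`[-π, π]`) with `∫ cos(k θ) dρ = c_k` for every `k` and total mass `c_0` (`exists_measure_of_toeplitzPSD`).
Proof: the Fejér measures `ρ_M = F_M(θ) dθ/(2πM)` have moments `(1-k/M)₊ c_k`, are supported in `[-π,π]`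
(tight), and a Prokhorov subsequential limit of the normalised family has moments `c_k`.
-/

noncomputable section

open scoped BigOperators Real Topology ENNReal
open Finset MeasureTheory Filter

namespace Summit.AtomisticToContinuum.FouriersLaw.Theorems.ContactStieltjesMeasure.CayleyPencil.Herglotz

/-! ### The Fejér measures -/

/-- The Fejér measure `ρ_M = F_M(θ) dθ / (2πM)` on `[-π, π]` (as a measure on `ℝ`). [folklore] -/
def fejerMeasure (c : ℕ → ℝ) (M : ℕ) : Measure ℝ :=
  (volume.restrict (Set.Icc (-π) π)).withDensity
    (fun θ => ENNReal.ofReal (fejerSum c M θ / (2 * π * M)))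

/-- The Fejér density `F_M(θ)/(2πM)` is nonnegative. [folklore] -/
theorem fejerDensity_nonneg {c : ℕ → ℝ}
    (hc : ∀ (a : ℕ → ℝ) (M : ℕ), 0 ≤ ∑ m ∈ range M, ∑ n ∈ range M, a m * a n * c (max m n - min m n))
    (M : ℕ) (θ : ℝ) :
    0 ≤ fejerSum c M θ / (2 * π * M) := by
  rcases Nat.eq_zero_or_pos M with rfl | hM
  · simp
  · exact div_nonneg (fejerSum_nonneg hc M θ) (by positivity)

/-- The Fejér density (as an `ℝ≥0∞`-valued function) is measurable. [folklore] -/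
theorem measurable_fejerDensity (c : ℕ → ℝ) (M : ℕ) :
    Measurable fun θ : ℝ => ENNReal.ofReal (fejerSum c M θ / (2 * π * M)) :=
  ((continuous_fejerSum c M).div_const _).measurable.ennreal_ofReal

/-- Integration against the Fejér measure is an interval integral against the density. [folklore] -/
theorem integral_fejerMeasure {c : ℕ → ℝ}
    (hc : ∀ (a : ℕ → ℝ) (M : ℕ), 0 ≤ ∑ m ∈ range M, ∑ n ∈ range M, a m * a n * c (max m n - min m n))
    (M : ℕ) (g : ℝ → ℝ) :
    ∫ θ, g θ ∂(fejerMeasure c M) = ∫ θ in (-π)..π, g θ * (fejerSum c M θ / (2 * π * M)) := by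
  unfold fejerMeasure
  rw [integral_withDensity_eq_integral_toReal_smul (measurable_fejerDensity c M)
    (Eventually.of_forall fun _ => ENNReal.ofReal_lt_top)]
  have e : (fun θ : ℝ => (ENNReal.ofReal (fejerSum c M θ / (2 * π * M))).toReal • g θ) =
      fun θ => g θ * (fejerSum c M θ / (2 * π * M)) := by
    funext θ
    rw [ENNReal.toReal_ofReal (fejerDensity_nonneg hc M θ), smul_eq_mul, mul_comm]
  rw [e, integral_Icc_eq_integral_Ioc, ← intervalIntegral.integral_of_le (by linarith [Real.pi_pos])]

/-- Moments of the Fejér measure: `∫ cos(kθ) dρ_M = (1 - k/M) c_k` for `k < M`, `0` otherwise. [folklore] -/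
theorem integral_cos_fejerMeasure {c : ℕ → ℝ}
    (hc : ∀ (a : ℕ → ℝ) (M : ℕ), 0 ≤ ∑ m ∈ range M, ∑ n ∈ range M, a m * a n * c (max m n - min m n))
    {M : ℕ} (hM : 0 < M) (k : ℕ) :
    ∫ θ, Real.cos (k * θ) ∂(fejerMeasure c M) = if k < M then (1 - (k : ℝ) / M) * c k else 0 := by
  rw [integral_fejerMeasure hc M]
  have e : (fun θ : ℝ => Real.cos (k * θ) * (fejerSum c M θ / (2 * π * M))) =
      fun θ => (1 / (2 * π * M)) * (Real.cos (k * θ) * fejerSum c M θ) := by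
    funext θ; ring
  rw [e, intervalIntegral.integral_const_mul, integral_cos_mul_fejerSum]
  have hM' : (0 : ℝ) < M := by exact_mod_cast hM
  have hπ := Real.pi_pos
  split_ifs with hk
  · field_simp
  · simp

/-- The Fejér measure lives on `[-π, π]`. [folklore] -/
theorem fejerMeasure_compl_Icc (c : ℕ → ℝ) (M : ℕ) : fejerMeasure c M (Set.Icc (-π) π)ᶜ = 0 := by
  unfold fejerMeasure
  rw [withDensity_apply _ (measurableSet_Icc.compl), Measure.restrict_restrict (measurableSet_Icc.compl),
    Set.compl_inter_self, Measure.restrict_empty, lintegral_zero_measure]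

/-- Total mass `c_0`. [folklore] -/
theorem fejerMeasure_univ {c : ℕ → ℝ}
    (hc : ∀ (a : ℕ → ℝ) (M : ℕ), 0 ≤ ∑ m ∈ range M, ∑ n ∈ range M, a m * a n * c (max m n - min m n))
    {M : ℕ} (hM : 0 < M) :
    fejerMeasure c M Set.univ = ENNReal.ofReal (c 0) := by
  have hint : Integrable (fun θ : ℝ => fejerSum c M θ / (2 * π * M)) (volume.restrict (Set.Icc (-π) π)) :=
    ((continuous_fejerSum c M).div_const _).continuousOn.integrableOn_compact isCompact_Icc
  unfold fejerMeasure
  rw [withDensity_apply _ MeasurableSet.univ, Measure.restrict_univ,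
    ← ofReal_integral_eq_lintegral_ofReal hint (Eventually.of_forall fun θ => fejerDensity_nonneg hc M θ)]
  congr 1
  have h := integral_cos_fejerMeasure hc hM 0
  rw [integral_fejerMeasure hc M] at h
  simp only [Nat.cast_zero, zero_mul, Real.cos_zero, one_mul, hM, if_true, zero_div, sub_zero] at h
  rw [integral_Icc_eq_integral_Ioc, ← intervalIntegral.integral_of_le (by linarith [Real.pi_pos])]
  exact h

/-- The Fejér measure is finite. [folklore] -/
instance isFiniteMeasure_fejerMeasure (c : ℕ → ℝ) (M : ℕ) : IsFiniteMeasure (fejerMeasure c M) := by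
  refine ⟨?_⟩
  unfold fejerMeasure
  rw [withDensity_apply _ MeasurableSet.univ, Measure.restrict_univ]
  have hint : Integrable (fun θ : ℝ => fejerSum c M θ / (2 * π * M)) (volume.restrict (Set.Icc (-π) π)) :=
    ((continuous_fejerSum c M).div_const _).continuousOn.integrableOn_compact isCompact_Icc
  calc ∫⁻ a in Set.Icc (-π) π, ENNReal.ofReal (fejerSum c M a / (2 * π * M))
      ≤ ∫⁻ a in Set.Icc (-π) π, ‖fejerSum c M a / (2 * π * M)‖ₑ :=
        lintegral_mono fun θ => Real.ofReal_le_enorm _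
    _ < ⊤ := hint.2

/-! ### Herglotz: extraction of the limit measure -/

/-- The bounded continuous function `cos(k ·)`. [folklore] -/
def cosBCF (k : ℕ) : BoundedContinuousFunction ℝ ℝ :=
  BoundedContinuousFunction.mkOfBound ⟨fun θ => Real.cos (k * θ), by fun_prop⟩ 2 (by
    intro x y
    rw [Real.dist_eq]
    have h1 := Real.abs_cos_le_one (k * x)
    have h2 := Real.abs_cos_le_one (k * y)
    calc |Real.cos (k * x) - Real.cos (k * y)| ≤ |Real.cos (k * x)| + |Real.cos (k * y)| := abs_sub _ _
      _ ≤ 2 := by linarith)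

/-- `cosBCF k θ = cos(k θ)`. [folklore] -/
theorem cosBCF_apply (k : ℕ) (θ : ℝ) : cosBCF k θ = Real.cos (k * θ) := rfl

/-- **Herglotz's theorem for positive-definite real sequences.** [folklore] -/
theorem exists_measure_of_toeplitzPSD {c : ℕ → ℝ}
    (hc : ∀ (a : ℕ → ℝ) (M : ℕ), 0 ≤ ∑ m ∈ range M, ∑ n ∈ range M, a m * a n * c (max m n - min m n)) :
    ∃ ρ : Measure ℝ, IsFiniteMeasure ρ ∧ ρ Set.univ = ENNReal.ofReal (c 0) ∧
      ∀ k : ℕ, ∫ θ, Real.cos (k * θ) ∂ρ = c k := by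
  rcases (toeplitzPSD_zero_nonneg hc).eq_or_lt with h0 | h0
  · -- `c 0 = 0`: everything vanishes
    refine ⟨0, inferInstance, by simp [← h0], fun k => ?_⟩
    have := toeplitzPSD_abs_le hc k
    rw [← h0] at this
    have hk : c k = 0 := abs_nonpos_iff.mp this
    simp [hk]
  -- `c 0 > 0`: normalise the Fejér measures to probability measures
  have hc0 : ENNReal.ofReal (c 0) ≠ 0 := by simpa using h0
  have hc0' : ENNReal.ofReal (c 0) ≠ ⊤ := ENNReal.ofReal_ne_top
  let μM : ℕ → Measure ℝ := fun M => (ENNReal.ofReal (c 0))⁻¹ • fejerMeasure c (M + 1)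
  have hprob : ∀ M, IsProbabilityMeasure (μM M) := by
    intro M
    refine ⟨?_⟩
    simp only [μM, Measure.smul_apply, smul_eq_mul]
    rw [fejerMeasure_univ hc (Nat.succ_pos M), ENNReal.inv_mul_cancel hc0 hc0']
  let μP : ℕ → ProbabilityMeasure ℝ := fun M => ⟨μM M, hprob M⟩
  have hμP : ∀ M, ((μP M : ProbabilityMeasure ℝ) : Measure ℝ) = μM M := fun M => rfl
  -- moments of the normalised measures
  have hmom : ∀ (k M : ℕ), ∫ θ, Real.cos (k * θ) ∂(μP M : Measure ℝ) =
      (c 0)⁻¹ * (if k < M + 1 then (1 - (k : ℝ) / (M + 1 : ℕ)) * c k else 0) := by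
    intro k M
    rw [hμP, integral_smul_measure, integral_cos_fejerMeasure hc (Nat.succ_pos M) k,
      ENNReal.toReal_inv, ENNReal.toReal_ofReal h0.le, smul_eq_mul]
  -- tightness: everything lives on `[-π, π]`
  have htight : IsTightMeasureSet {((μ : ProbabilityMeasure ℝ) : Measure ℝ) | μ ∈ Set.range μP} := by
    rw [isTightMeasureSet_iff_exists_isCompact_measure_compl_le]
    intro ε hε
    refine ⟨Set.Icc (-π) π, isCompact_Icc, fun μ hμ => ?_⟩
    obtain ⟨ν, ⟨M, rfl⟩, rfl⟩ := hμ
    rw [hμP]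
    simp only [μM, Measure.smul_apply, smul_eq_mul, fejerMeasure_compl_Icc, mul_zero]
    exact zero_le
  have hcomp : IsCompact (closure (Set.range μP)) := isCompact_closure_of_isTightMeasureSet htight
  obtain ⟨ν, -, φ, hφ, hconv⟩ :=
    hcomp.tendsto_subseq (fun n => subset_closure (Set.mem_range_self n))
  -- moments pass to the limit
  have hlim : ∀ k : ℕ, ∫ θ, Real.cos (k * θ) ∂(ν : Measure ℝ) = (c 0)⁻¹ * c k := by
    intro k
    have h1 := (ProbabilityMeasure.tendsto_iff_forall_integral_tendsto.1 hconv) (cosBCF k)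
    simp only [Function.comp_apply, cosBCF_apply] at h1
    -- the explicit moments converge to `(c 0)⁻¹ c k`
    have h2 : Tendsto (fun i => ∫ θ, Real.cos (k * θ) ∂(μP (φ i) : Measure ℝ)) atTop
        (𝓝 ((c 0)⁻¹ * c k)) := by
      simp_rw [hmom]
      have hφ' : Tendsto φ atTop atTop := hφ.tendsto_atTop
      have hev : ∀ᶠ i in atTop, (c 0)⁻¹ * (if k < φ i + 1 then (1 - (k : ℝ) / (φ i + 1 : ℕ)) * c k else 0) =
          (c 0)⁻¹ * ((1 - (k : ℝ) / (φ i + 1 : ℕ)) * c k) := by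
        filter_upwards [hφ'.eventually_ge_atTop k] with i hi
        rw [if_pos (by omega)]
      refine Tendsto.congr' (EventuallyEq.symm hev) ?_
      have h3 : Tendsto (fun i => (k : ℝ) / (φ i + 1 : ℕ)) atTop (𝓝 0) := by
        have : Tendsto (fun i => ((φ i + 1 : ℕ) : ℝ)) atTop atTop := by
          exact tendsto_natCast_atTop_atTop.comp (tendsto_add_atTop_nat 1 |>.comp hφ')
        exact tendsto_const_nhds.div_atTop this
      have h4 : Tendsto (fun i => (c 0)⁻¹ * ((1 - (k : ℝ) / (φ i + 1 : ℕ)) * c k)) atTop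
          (𝓝 ((c 0)⁻¹ * ((1 - 0) * c k))) :=
        ((tendsto_const_nhds.sub h3).mul tendsto_const_nhds).const_mul _
      simpa using h4
    exact tendsto_nhds_unique h1 h2
  -- the limit measure, rescaled by `c 0`
  refine ⟨ENNReal.ofReal (c 0) • (ν : Measure ℝ), ⟨?_⟩, ?_, fun k => ?_⟩
  · rw [Measure.smul_apply, smul_eq_mul, measure_univ, mul_one]; exact ENNReal.ofReal_lt_top
  · rw [Measure.smul_apply, smul_eq_mul, measure_univ, mul_one]
  · rw [integral_smul_measure, hlim k, ENNReal.toReal_ofReal h0.le, smul_eq_mul, ← mul_assoc,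
      mul_inv_cancel₀ h0.ne', one_mul]

/-! ### Registered sub-goal of `stub_stieltjesOfPencil` closed by this file -/

/-- **Sub-goal `stub_stieltjesOfPencil_herglotz`** (part 3/5 of `stub_stieltjesOfPencil`, line `cayley-pencil`):
Herglotz's theorem for Toeplitz-positive real sequences — a finite measure on `ℝ` of total mass `c 0` with cosine
moments `c k` (`exists_measure_of_toeplitzPSD`). [folklore] -/
theorem stub_stieltjesOfPencil_herglotz :
    ∀ c : ℕ → ℝ,
      (∀ (a : ℕ → ℝ) (M : ℕ), 0 ≤ ∑ m ∈ Finset.range M, ∑ n ∈ Finset.range M, a m * a n * c (max m n - min m n)) →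
      ∃ ρ : MeasureTheory.Measure ℝ, MeasureTheory.IsFiniteMeasure ρ ∧ ρ Set.univ = ENNReal.ofReal (c 0) ∧
        ∀ k : ℕ, ∫ θ, Real.cos (k * θ) ∂ρ = c k := by
  intro c hc
  exact exists_measure_of_toeplitzPSD hc

end Summit.AtomisticToContinuum.FouriersLaw.Theorems.ContactStieltjesMeasure.CayleyPencil.Herglotz

end
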